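import Literature.Computability.AlgebraicComplexity.MS2001ClassVarieties
import Literature.Computability.AlgebraicComplexity.PolystabilityProofs
import HarnessLib

/-!
# GCT I, Thm. 7.3 over `ℂ`: the P-vs-NP form `E(X)` has a closed `SL`-orbit (is polystable)

Companion of `Literature/Computability/AlgebraicComplexity/MS2001ClassVarieties.lean` (K. D. Mulmuley,
M. Sohoni, *Geometric complexity theory I: an approach to the P vs. NP and related problems*,
SIAM J. Comput. **31** (2001) 496–526 [bib `MulmuleySohoniSIAM2001`]; text of record = the
authors' version (AV) of 2001-04-23, `run/shared/lean/pub/val-lit/bip/texts/MS2001-authorversion/`,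
cited as `AV p.N (all.txt Lnnnn)`). No named facts; four plumbing definitions (`contentClassCard`,
`symTensor`, `relabel`, `relabelChoice`); everything else is a proved theorem.

GCT I §7 attaches to the P-vs-NP problem (integer programming / SAT over `F_p`) the form
`E(X) = ∏_{σ : [m] → [k]} det_σ(X)` of the `m × km` variable matrix `X = (X^j_i)` (AV p.30; the
tree's `msE F m k`, variables indexed by `Fin m × (Fin m × Fin k)` = (row, (block, column))), and
states, with `n = km²` and `W` the forms of degree `deg E(X)`:

* **Thm. 7.3** (AV p.31, all.txt L2342–2347; journal numbering inferred: Thm. 7.1): "The point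
  `E(X) ∈ P(W)` is stable with respect to the action of `G = SL_n(F)` on `P(W)`. We assume that
  the characteristic does not divide `k`, `k − 1`, or `m`." — "stable" in the sense of MS §3.1
  (AV p.7): the `G`-orbit of an affine representative is (Zariski) closed, i.e. the tree's
  `IsPolystable` (Bürgisser–Ikenmeyer 2017 Def. 2.7, `Polystability.lean`). The printed proof is
  §8 of the paper (AV pp.34–37): Kempf's criterion via an analysis of one-parameter subgroups.

The tree vendors the statement over EVERY algebraically closed field as the named fact
`MS2001_thm_7_3` (open: Kempf / Hilbert–Mumford in arbitrary characteristic are absent). THIS FILE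
PROVES THE INSTANCE `F = ℂ` — `MS2001_thm_7_3_complex`, in fact `isPolystable_msE_complex` for
EVERY `m, k` (the characteristic provisos of the source are not needed at characteristic `0`; for
`k = 1`, `E(X) = det_m` and the statement is Thm. 4.6 = Bürgisser–Ikenmeyer Cor. 2.9) — NOT by
the printed §8 argument but by the tree's **Kempf–Ness route**
`isPolystable_tensorToPoly_of_momentMatrix_eq_smul_one` (`PolystabilityProofs.lean`: a form that is
the polynomial shadow of a SYMMETRIC tensor with SCALAR moment matrix has a closed `SL`-orbit —
Kempf–Ness closedness of critical orbits + Chevalley/SGA1 transfer to the Zariski topology), the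
route by which the tree proves `det_n`, `per_n` (`BurgisserIkenmeyer2017_polystable_det_per_holds`)
and `x₁⋯x_m`, `∑ x_i^D` (`BI17ChowPowerSumPolystableProofs.lean`) polystable:

1. **Symmetric tensor of a form** (`symTensor D f`; generic, any alphabet `σ`): the word `j` carries
   `coeff (content j) f` divided by the number of words with that content; it is symmetric in the
   slots, and for `f` homogeneous of degree `D` its polynomial shadow is `f`
   (`tensorToPoly_symTensor`; uses `exists_tcontent_eq`: every exponent vector of degree `D` is
   the content of a word); relabelling the alphabet by `ρ` acts through `rename ρ⁻¹`
   (`symTensor_comp_left`).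
2. **A moment criterion** (`exists_momentMatrix_eq_smul_one_of_rigid_of_transitive`; generic):
   if the support of a tensor is RIGID (no two support words differ in exactly one slot) the
   off-diagonal moment entries vanish, and if a family of SIGN-symmetries (`S (ρ ∘ j) = ε S j`,
   `‖ε‖ = 1`) is transitive on the alphabet the diagonal entries agree; so the moment matrix is
   scalar. (The moment-map form of the cone condition of Bürgisser–Ikenmeyer 2017 Prop. 2.8; cf.
   the all-permutations version in `BI17ChowPowerSumPolystableProofs.lean`.)
3. **`E(X)` is rigid** (`symTensor_msE_rigid`): `E(X)` is multihomogeneous — every monomial has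
   the same degree in each ROW of `X` (each `det_σ` is linear in each row) and in each COLUMN of
   `X` (`det_σ` has degree `[σ i = j]` in column `(i, j)`) (`isWeightedHomogeneous_msE`, from a
   weighted-homogeneity lemma for determinants of variable matrices, `isWeightedHomogeneous_det_X`)
   — so two monomials differing by moving one unit of degree between two variables cannot both
   occur (`weight_eq_of_coeff_tcontent_ne_zero`).
4. **`E(X)` has transitive sign-symmetries** (`rename_relabel_msE`, `exists_relabel_apply_eq`):
   `(r, (i, j)) ↦ (ρ r, (κ i, π_i j))` (rows by `ρ`, column blocks by `κ`, columns inside block `i`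
   by `π_i`) sends `det_σ` to `sign κ · sign ρ · det_{σ'}` with `σ ↦ σ'` a bijection of the
   choice functions (`relabelChoice`, `rename_relabel_det`: `Matrix.det_permute`/`det_permute'`),
   hence `E ↦ (sign κ sign ρ)^{k^m} E`; these maps are transitive on the variables (swaps).

HONEST FRAMING. A kernel proof, at `F = ℂ`, of the stability statement GCT I attaches to its
P-vs-NP class variety; it says nothing about the CONJECTURES of GCT I §7 (7.5–7.11), constructs no
obstruction, and neither P ≠ NP nor VP ≠ VNP is proved here or anywhere in the tree. The
arbitrary-characteristic fact `MS2001_thm_7_3` is NOT discharged (no partial discharge of a named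
fact is possible or attempted).

## References

* K. D. Mulmuley, M. Sohoni, *Geometric complexity theory I*, SIAM J. Comput. 31 (2001)
  496–526, §7 (the form `E(X)`), Thm. 7.3 (authors' version; journal Thm. 7.1), §8 (printed
  proof). [MulmuleySohoniSIAM2001]
* P. Bürgisser, C. Ikenmeyer, *Fundamental invariants of orbit closures*, J. Algebra 477 (2017)
  390–434, Def. 2.7 (polystable), Prop. 2.8, Cor. 2.9. [BurgisserIkenmeyer2017]
* G. Kempf, L. Ness, *The length of vectors in representation spaces*, LNM 732 (1979), Thm. 0.1–0.2
  (the route of `PolystabilityProofs.lean` / `KempfNessClosedOrbit.lean`).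

## Tree

`msE` (`MS2001ClassVarieties.lean`); `IsPolystable` (`Polystability.lean`); `tcontent`,
`tensorToPoly`, `coeff_tensorToPoly`, `momentMatrix`, `momentMatrix_apply(_self)`,
`isPolystable_tensorToPoly_of_momentMatrix_eq_smul_one` (`TensorPowerAction.lean`,
`TensorMomentMatrix.lean`, `PolystabilityProofs.lean`). Standard axioms only; no `instance`, no
`notation`.
-/

noncomputable section

open MvPolynomial Finset

namespace Literature.Computability.AlgebraicComplexity

namespace MS2001Thm73

/-! ### Words, contents, and the symmetric tensor of a form -/

section SymTensor

variable {σ : Type*} [Fintype σ] [DecidableEq σ] {D : ℕ}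

omit [Fintype σ] [DecidableEq σ] in
/-- The content of a word is unchanged by permuting its slots. [folklore] -/
private theorem tcontent_comp_perm (j : Fin D → σ) (π : Equiv.Perm (Fin D)) :
    tcontent (j ∘ π) = tcontent j := by
  unfold tcontent
  exact Equiv.sum_comp π (fun k => Finsupp.single (j k) 1)

omit [Fintype σ] [DecidableEq σ] in
/-- Relabelling the alphabet maps the content: `tcontent (ρ ∘ j) = mapDomain ρ (tcontent j)`.
[folklore] -/
private theorem tcontent_comp_left (ρ : σ → σ) (j : Fin D → σ) :
    tcontent (ρ ∘ j) = Finsupp.mapDomain ρ (tcontent j) := by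
  unfold tcontent
  rw [Finsupp.mapDomain_finsetSum]
  simp_rw [Finsupp.mapDomain_single]
  rfl

omit [Fintype σ] [DecidableEq σ] in
/-- Prepending a letter adds it to the content: `tcontent (Fin.cons x j) = single x 1 + tcontent j`.
[folklore] -/
private theorem tcontent_cons (x : σ) (j : Fin D → σ) :
    tcontent (Fin.cons x j : Fin (D + 1) → σ) = Finsupp.single x 1 + tcontent j := by
  unfold tcontent
  rw [Fin.sum_univ_succ]
  simp only [Fin.cons_zero, Fin.cons_succ]

omit [Fintype σ] in
/-- **Every exponent vector of degree `D` is the content of a word of length `D`.** [folklore] -/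
private theorem exists_tcontent_eq : ∀ (D : ℕ) (α : σ →₀ ℕ), α.degree = D → ∃ j : Fin D → σ, tcontent j = α
  | 0, α, h => by
    refine ⟨Fin.elim0, ?_⟩
    have hα : α = 0 := (Finsupp.degree_eq_zero_iff α).mp h
    subst hα
    unfold tcontent
    simp
  | D + 1, α, h => by
    have hne : α ≠ 0 := by
      intro h0; rw [h0, map_zero] at h; exact Nat.succ_ne_zero D h.symm
    obtain ⟨x, hx⟩ := Finsupp.ne_iff.mp hne
    simp only [Finsupp.coe_zero, Pi.zero_apply] at hx
    set α' : σ →₀ ℕ := α - Finsupp.single x 1 with hα'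
    have hsum : Finsupp.single x 1 + α' = α := by
      rw [hα', add_tsub_cancel_of_le]
      intro y
      by_cases hy : y = x
      · subst hy; rw [Finsupp.single_eq_same]; exact Nat.one_le_iff_ne_zero.mpr hx
      · rw [Finsupp.single_eq_of_ne hy]; exact Nat.zero_le _
    have hdeg : α'.degree = D := by
      have := congrArg Finsupp.degree hsum
      rw [map_add, Finsupp.degree_single, h] at this
      omega
    obtain ⟨j', hj'⟩ := exists_tcontent_eq D α' hdeg
    exact ⟨Fin.cons x j', by rw [tcontent_cons, hj', hsum]⟩

omit [Fintype σ] [DecidableEq σ] in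
/-- Changing one slot of a word: `tcontent (update j k b) + single (j k) 1 = tcontent j + single b 1`.
[folklore] -/
private theorem tcontent_update_add (j : Fin D → σ) (k : Fin D) (b : σ) :
    tcontent (Function.update j k b) + Finsupp.single (j k) 1 =
      tcontent j + Finsupp.single b 1 := by
  unfold tcontent
  rw [← Finset.add_sum_erase _ _ (Finset.mem_univ k),
    ← Finset.add_sum_erase _ (fun k => Finsupp.single (j k) 1) (Finset.mem_univ k),
    Function.update_self]
  have h : ∑ x ∈ Finset.univ.erase k, Finsupp.single (Function.update j k b x) 1 =
      ∑ x ∈ Finset.univ.erase k, Finsupp.single (j x) 1 := by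
    refine Finset.sum_congr rfl fun x hx => ?_
    rw [Function.update_of_ne (Finset.ne_of_mem_erase hx)]
  rw [h]
  abel

/-- The number of words with the same content as `j` (a multinomial coefficient); positive since
`j` is one of them. [folklore] -/
def contentClassCard (j : Fin D → σ) : ℕ :=
  Fintype.card {j' : Fin D → σ // tcontent j' = tcontent j}

/-- `contentClassCard j ≠ 0`. [folklore] -/
private theorem contentClassCard_ne_zero (j : Fin D → σ) : contentClassCard j ≠ 0 :=
  (Fintype.card_pos_iff.mpr ⟨⟨j, rfl⟩⟩).ne'

/-- `contentClassCard` depends only on the content. [folklore] -/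
private theorem contentClassCard_congr {j j' : Fin D → σ} (h : tcontent j' = tcontent j) :
    contentClassCard j' = contentClassCard j := by
  unfold contentClassCard
  simp_rw [h]

/-- `contentClassCard` is invariant under relabelling the alphabet by a permutation. [folklore] -/
private theorem contentClassCard_comp_left (ρ : Equiv.Perm σ) (j : Fin D → σ) :
    contentClassCard (ρ ∘ j) = contentClassCard j := by
  unfold contentClassCard
  refine Fintype.card_congr (Equiv.subtypeEquiv (Equiv.arrowCongr (Equiv.refl (Fin D)) ρ.symm) ?_)
  intro j'
  have he : (Equiv.arrowCongr (Equiv.refl (Fin D)) ρ.symm) j' = ρ.symm ∘ j' := by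
    funext k; simp [Equiv.arrowCongr_apply]
  rw [he, tcontent_comp_left, tcontent_comp_left]
  constructor
  · intro h
    rw [h, ← Finsupp.mapDomain_comp, ρ.symm_comp_self, Finsupp.mapDomain_id]
  · intro h
    have := congrArg (Finsupp.mapDomain ρ) h
    rwa [← Finsupp.mapDomain_comp, ρ.self_comp_symm, Finsupp.mapDomain_id] at this

/-- **The symmetric tensor of a polynomial** (its degree-`D` symmetrization): the word `j` carries
the coefficient of `x^{content j}` divided by the number of words with that content. [folklore] -/
def symTensor (D : ℕ) (f : MvPolynomial σ ℂ) : (Fin D → σ) → ℂ :=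
  fun j => coeff (tcontent j) f / contentClassCard j

/-- Unfolding `symTensor`. [folklore] -/
private theorem symTensor_apply (f : MvPolynomial σ ℂ) (j : Fin D → σ) :
    symTensor D f j = coeff (tcontent j) f / contentClassCard j := rfl

/-- `symTensor` is symmetric in the slots — forms `w ∈ Sym^D ℂ^m` as symmetric tensors, the
identification Bürgisser–Ikenmeyer use throughout §2.2 (OUR formalization of it).
[cite: BurgisserIkenmeyer2017, §2.2 (Def. 2.7: forms w ∈ Sym^D ℂ^m; arXiv p. 6, held p0006.txt:L131)] -/
theorem symTensor_comp_perm (f : MvPolynomial σ ℂ) (π : Equiv.Perm (Fin D)) (j : Fin D → σ) :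
    symTensor D f (j ∘ π) = symTensor D f j := by
  rw [symTensor_apply, symTensor_apply, contentClassCard_congr (tcontent_comp_perm j π),
    tcontent_comp_perm]

/-- `symTensor` is additive-homogeneous in `f`: scalars pull out. [folklore] -/
private theorem symTensor_smul (c : ℂ) (f : MvPolynomial σ ℂ) (j : Fin D → σ) :
    symTensor D (c • f) j = c * symTensor D f j := by
  rw [symTensor_apply, symTensor_apply, coeff_smul, smul_eq_mul, mul_div_assoc]

/-- The support of `symTensor D f` lies over the support of `f`. [folklore] -/
private theorem coeff_ne_zero_of_symTensor_ne_zero {f : MvPolynomial σ ℂ} {j : Fin D → σ}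
    (h : symTensor D f j ≠ 0) : coeff (tcontent j) f ≠ 0 := by
  intro h0
  rw [symTensor_apply, h0, zero_div] at h
  exact h rfl

/-- **The polynomial shadow of the symmetric tensor of a form of degree `D` is the form** — the
identification `Sym^D ℂ^m` = symmetric `D`-tensors behind Bürgisser–Ikenmeyer §2.2 (OUR
formalization; not a numbered statement of the source).
[cite: BurgisserIkenmeyer2017, §2.2 (Def. 2.7: forms w ∈ Sym^D ℂ^m; arXiv p. 6, held p0006.txt:L131)] -/
theorem tensorToPoly_symTensor {f : MvPolynomial σ ℂ} (hf : f.IsHomogeneous D) :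
    tensorToPoly (symTensor D f) = f := by
  ext α
  rw [coeff_tensorToPoly]
  by_cases hα : ∃ j : Fin D → σ, tcontent j = α
  · obtain ⟨j₀, rfl⟩ := hα
    have hconst : ∀ j ∈ Finset.univ.filter (fun j : Fin D → σ => tcontent j = tcontent j₀),
        symTensor D f j = coeff (tcontent j₀) f / contentClassCard j₀ := by
      intro j hj
      rw [Finset.mem_filter] at hj
      rw [symTensor_apply, hj.2, contentClassCard_congr hj.2]
    rw [Finset.sum_congr rfl hconst, Finset.sum_const, nsmul_eq_mul]
    have hcard : (Finset.univ.filter (fun j : Fin D → σ => tcontent j = tcontent j₀)).card =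
        contentClassCard j₀ := by
      rw [contentClassCard, Fintype.card_subtype]
    rw [hcard, mul_div_cancel₀]
    exact Nat.cast_ne_zero.mpr (contentClassCard_ne_zero j₀)
  · have hsum : ∑ j ∈ Finset.univ.filter (fun j : Fin D → σ => tcontent j = α), symTensor D f j = 0 := by
      refine Finset.sum_eq_zero fun j hj => ?_
      rw [Finset.mem_filter] at hj
      exact absurd ⟨j, hj.2⟩ hα
    rw [hsum]
    by_cases hdeg : α.degree = D
    · exact absurd (exists_tcontent_eq D α hdeg) hα
    · exact (hf.coeff_eq_zero hdeg).symm

/-- **Relabelling the alphabet** acts on the symmetric tensor through `rename` by the inverse: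
`symTensor D f (ρ ∘ j) = symTensor D (rename ρ⁻¹ f) j` (equivariance of the identification
form ↔ symmetric tensor under coordinate permutations; OUR formalization).
[cite: BurgisserIkenmeyer2017, §2.2 (Def. 2.7: forms w ∈ Sym^D ℂ^m; arXiv p. 6, held p0006.txt:L131)] -/
theorem symTensor_comp_left (ρ : Equiv.Perm σ) (f : MvPolynomial σ ℂ) (j : Fin D → σ) :
    symTensor D f (ρ ∘ j) = symTensor D (rename ρ.symm f) j := by
  rw [symTensor_apply, symTensor_apply, contentClassCard_comp_left, tcontent_comp_left]
  congr 1
  conv_lhs => rw [show f = rename ρ (rename ρ.symm f) by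
    rw [rename_rename, ρ.self_comp_symm, rename_id, AlgHom.id_apply]]
  exact coeff_rename_mapDomain ρ ρ.injective _ _

end SymTensor

/-! ### A moment-matrix criterion: rigid support and transitive sign-symmetries -/

section Moment

variable {σ : Type*} [Fintype σ] [DecidableEq σ] {n : ℕ}

/-- **Rigid support ⇒ off-diagonal moment entries vanish**: if no two words in the support of `S`
differ in exactly one slot then `momentMatrix S a b = 0` for `a ≠ b`. [folklore] -/
private theorem momentMatrix_apply_eq_zero_of_rigid (S : (Fin n → σ) → ℂ)
    (hrigid : ∀ (j : Fin n → σ) (k : Fin n) (b : σ),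
      S j ≠ 0 → S (Function.update j k b) ≠ 0 → b = j k)
    {a b : σ} (hab : a ≠ b) : momentMatrix S a b = 0 := by
  rw [momentMatrix_apply]
  refine Finset.sum_eq_zero fun k _ => Finset.sum_eq_zero fun j _ => ?_
  by_cases hjk : j k = a
  · rw [if_pos hjk]
    by_cases hS : S j = 0
    · rw [hS, mul_zero]
    by_cases hS' : S (Function.update j k b) = 0
    · rw [hS', map_zero, zero_mul]
    exact absurd (hjk.symm.trans (hrigid j k b hS hS').symm) hab
  · rw [if_neg hjk]

/-- **Sign-symmetries transport diagonal moment entries**: if `S (ρ ∘ j) = ε S j` for all words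
`j`, with `‖ε‖ = 1`, then `momentMatrix S (ρ a) (ρ a) = momentMatrix S a a`. [folklore] -/
private theorem momentMatrix_apply_self_relabel (S : (Fin n → σ) → ℂ) (ρ : Equiv.Perm σ) {ε : ℂ}
    (hε : ‖ε‖ = 1) (hrel : ∀ j : Fin n → σ, S (ρ ∘ j) = ε * S j) (a : σ) :
    momentMatrix S (ρ a) (ρ a) = momentMatrix S a a := by
  rw [momentMatrix_apply_self, momentMatrix_apply_self]
  refine Finset.sum_congr rfl fun k _ => ?_
  symm
  refine Fintype.sum_equiv (Equiv.piCongrRight fun _ : Fin n => ρ) _ _ fun j => ?_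
  have he : (Equiv.piCongrRight fun _ : Fin n => ρ) j = ρ ∘ j := rfl
  rw [he, hrel, norm_mul, hε, one_mul]
  have hiff : j k = a ↔ (ρ ∘ j) k = ρ a := by
    rw [Function.comp_apply]
    exact ρ.apply_eq_iff_eq.symm
  exact if_congr hiff rfl rfl

/-- **Scalar moment matrix from a rigid support and a transitive family of sign-symmetries** —
the moment-map (Kempf–Ness critical point) form of the polystability test Bürgisser–Ikenmeyer
2017 Prop. 2.8 («There is a reductive subgroup R of SL_m ∩ stab(w) such that the centralizer of R
in SL_m is contained in the group of diagonal matrices» + «The convex cone generated by supp(w)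
contains (1,…,1)»), in the variant this file needs: rigidity kills the off-diagonal moment entries,
a TRANSITIVE family of sign-symmetries (not all coordinate permutations, cf. the criterion of
`BI17ChowPowerSumPolystableProofs.lean`) equalizes the diagonal. OUR formulation — an
intermediate step, not a statement printed in the source.
[cite: BurgisserIkenmeyer2017, Prop. 2.8 (arXiv p. 6, held p0006.txt:L139–147) — moment-map form] -/
theorem exists_momentMatrix_eq_smul_one_of_rigid_of_transitive (S : (Fin n → σ) → ℂ)
    (hrigid : ∀ (j : Fin n → σ) (k : Fin n) (b : σ),
      S j ≠ 0 → S (Function.update j k b) ≠ 0 → b = j k)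
    (htrans : ∀ a b : σ, ∃ (ρ : Equiv.Perm σ) (ε : ℂ),
      ‖ε‖ = 1 ∧ ρ a = b ∧ ∀ j : Fin n → σ, S (ρ ∘ j) = ε * S j) :
    ∃ c : ℂ, momentMatrix S = c • (1 : Matrix σ σ ℂ) := by
  by_cases hσ : Nonempty σ
  · obtain ⟨a₀⟩ := hσ
    refine ⟨momentMatrix S a₀ a₀, ?_⟩
    ext a b
    rw [Matrix.smul_apply, smul_eq_mul]
    by_cases hab : a = b
    · subst hab
      rw [Matrix.one_apply_eq, mul_one]
      obtain ⟨ρ, ε, hε, hρ, hrel⟩ := htrans a₀ a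
      rw [← hρ]
      exact momentMatrix_apply_self_relabel S ρ hε hrel a₀
    · rw [Matrix.one_apply_ne hab, mul_zero]
      exact momentMatrix_apply_eq_zero_of_rigid S hrigid hab
  · refine ⟨0, ?_⟩
    ext a b
    exact absurd ⟨a⟩ hσ

end Moment

/-! ### Weighted homogeneity and rigidity -/

section Rigid

variable {σ : Type*} {D : ℕ}

/-- **One-slot changes are detected by weights**: if `f` is weighted-homogeneous for `w` and both
`x^{content j}` and `x^{content (update j k b)}` occur in `f`, then `w b = w (j k)`. [folklore] -/
private theorem weight_eq_of_coeff_tcontent_ne_zero {w : σ → ℕ} {f : MvPolynomial σ ℂ} {N : ℕ}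
    (hf : IsWeightedHomogeneous w f N) {j : Fin D → σ} {k : Fin D} {b : σ}
    (h1 : coeff (tcontent j) f ≠ 0) (h2 : coeff (tcontent (Function.update j k b)) f ≠ 0) :
    w b = w (j k) := by
  have e1 : Finsupp.weight w (tcontent j) = N := hf h1
  have e2 : Finsupp.weight w (tcontent (Function.update j k b)) = N := hf h2
  have h := congrArg (Finsupp.weight w) (tcontent_update_add j k b)
  rw [map_add, map_add, e1, e2, Finsupp.weight_single, Finsupp.weight_single, one_smul,
    one_smul] at h
  exact (add_left_cancel h).symm

end Rigid

/-! ### The form `E(X)`: multihomogeneity and sign-symmetries -/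

section FormE

variable {m kk : ℕ}

/-- **Determinants of variable matrices are weighted-homogeneous** for every weight that splits
as row part + column part on the entries used. [folklore] -/
private theorem isWeightedHomogeneous_det_X {M : Type*} [AddCommMonoid M]
    (w : Fin m × (Fin m × Fin kk) → M) (e : Fin m → Fin m × Fin kk) (p q : Fin m → M)
    (hw : ∀ r c, w (r, e c) = p r + q c) :
    IsWeightedHomogeneous w
      (Matrix.of fun r c : Fin m => (X (r, e c) : MvPolynomial (Fin m × (Fin m × Fin kk)) ℂ)).det
      (∑ r, p r + ∑ c, q c) := by
  rw [Matrix.det_apply]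
  refine IsWeightedHomogeneous.sum _ _ _ fun τ _ => ?_
  rw [Units.smul_def, zsmul_eq_mul, ← map_intCast (C : ℂ →+* MvPolynomial _ ℂ), ← zero_add (∑ r, p r + ∑ c, q c)]
  refine (isWeightedHomogeneous_C w _).mul ?_
  have hprod := IsWeightedHomogeneous.prod Finset.univ
    (fun i : Fin m => (Matrix.of fun r c : Fin m =>
      (X (r, e c) : MvPolynomial (Fin m × (Fin m × Fin kk)) ℂ)) (τ i) i)
    (fun i => p (τ i) + q i) (w := w) (fun i _ => by
      rw [Matrix.of_apply, ← hw]
      exact isWeightedHomogeneous_X ℂ w _)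
  have hsum : ∑ i ∈ Finset.univ, (p (τ i) + q i) = ∑ r, p r + ∑ c, q c := by
    rw [Finset.sum_add_distrib, Equiv.sum_comp τ p]
  rwa [hsum] at hprod

/-- **`E(X)` is weighted-homogeneous** for every weight splitting as row part + (per factor) column
part: weight `∑_σ (∑_r p r + ∑_c q σ c)` — the multihomogeneity of `E(X) = ∏_σ det_σ(X)` in the
rows and the columns of `X` (each `det_σ` is linear in every row and in the columns `(i, σ i)`),
read off the definition of `E(X)` (GCT I §7, AV p.30: «let det_σ(X) denote the determinant of the
matrix whose i-th column is X^{σ(i)}_i. Define E(X) = ∏_σ det_σ(X)»); OUR formulation.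
[cite: MulmuleySohoniSIAM2001, §7 (definition of E(X), AV p.30)] -/
theorem isWeightedHomogeneous_msE {M : Type*} [AddCommMonoid M]
    (w : Fin m × (Fin m × Fin kk) → M) (p : Fin m → M) (q : (Fin m → Fin kk) → Fin m → M)
    (hw : ∀ (σ : Fin m → Fin kk) r c, w (r, (c, σ c)) = p r + q σ c) :
    IsWeightedHomogeneous w (msE ℂ m kk) (∑ σ : Fin m → Fin kk, (∑ r, p r + ∑ c, q σ c)) := by
  unfold msE
  exact IsWeightedHomogeneous.prod Finset.univ _ _ fun σ _ =>
    isWeightedHomogeneous_det_X w (fun c => (c, σ c)) p (q σ) (hw σ)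

/-- **`E(X)` is a form of degree `d = m·k^m`** (`k^m` factors `det_σ`, each of degree `m`; «Let d
be the total degree of E(X)», AV p.31, all.txt L2329). [cite: MulmuleySohoniSIAM2001, §7 / Prop. 7.2 (the degree d of E(X), AV p.31)] -/
theorem isHomogeneous_msE (m kk : ℕ) : (msE ℂ m kk).IsHomogeneous (m * kk ^ m) := by
  have h := isWeightedHomogeneous_msE (m := m) (kk := kk) (1 : Fin m × (Fin m × Fin kk) → ℕ)
    (fun _ => 1) (fun _ _ => 0) (fun σ r c => by simp)
  simp only [Finset.sum_const, Finset.card_univ, Fintype.card_fin, smul_eq_mul, mul_one,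
    mul_zero, add_zero, Fintype.card_fun] at h
  rw [mul_comm] at h
  exact h

/-- **Row-multihomogeneity**: in every monomial of `E(X)` each row of `X` has the same total
degree (namely `k^m`). [folklore] -/
private theorem isWeightedHomogeneous_msE_row (r₀ : Fin m) :
    ∃ N : ℕ, IsWeightedHomogeneous (fun v : Fin m × (Fin m × Fin kk) => if v.1 = r₀ then 1 else 0)
      (msE ℂ m kk) N :=
  ⟨_, isWeightedHomogeneous_msE _ (fun r => if r = r₀ then 1 else 0) (fun _ _ => 0)
    (fun σ r c => by simp)⟩

/-- **Column-multihomogeneity**: in every monomial of `E(X)` each column of `X` has the same total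
degree (namely `k^{m-1}`). [folklore] -/
private theorem isWeightedHomogeneous_msE_col (c₀ : Fin m × Fin kk) :
    ∃ N : ℕ, IsWeightedHomogeneous (fun v : Fin m × (Fin m × Fin kk) => if v.2 = c₀ then 1 else 0)
      (msE ℂ m kk) N :=
  ⟨_, isWeightedHomogeneous_msE _ (fun _ => 0) (fun σ c => if (c, σ c) = c₀ then 1 else 0)
    (fun σ r c => by simp)⟩

/-- **The support of `E(X)` is rigid**: no two monomials of `E(X)` differ by moving one unit of
degree from one variable to another (row- and column-multihomogeneity); in tensor language, no two
support words of its symmetric tensor differ in exactly one slot. [folklore] -/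
private theorem symTensor_msE_rigid {D : ℕ} (j : Fin D → Fin m × (Fin m × Fin kk)) (k : Fin D)
    (b : Fin m × (Fin m × Fin kk)) (h1 : symTensor D (msE ℂ m kk) j ≠ 0)
    (h2 : symTensor D (msE ℂ m kk) (Function.update j k b) ≠ 0) : b = j k := by
  have c1 := coeff_ne_zero_of_symTensor_ne_zero h1
  have c2 := coeff_ne_zero_of_symTensor_ne_zero h2
  obtain ⟨N₁, hrow⟩ := isWeightedHomogeneous_msE_row (m := m) (kk := kk) (j k).1
  obtain ⟨N₂, hcol⟩ := isWeightedHomogeneous_msE_col (m := m) (kk := kk) (j k).2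
  have hr := weight_eq_of_coeff_tcontent_ne_zero hrow c1 c2
  have hc := weight_eq_of_coeff_tcontent_ne_zero hcol c1 c2
  simp only [if_true] at hr hc
  refine Prod.ext ?_ ?_
  · by_contra hne; rw [if_neg hne] at hr; exact zero_ne_one hr
  · by_contra hne; rw [if_neg hne] at hc; exact zero_ne_one hc

/-- **The relabelling symmetries of `E(X)`**: permute the rows by `ρ`, the column blocks by `κ`,
and the columns inside block `i` by `π i` — `(r, (i, j)) ↦ (ρ r, (κ i, π_i j))`. [folklore] -/
def relabel (ρ κ : Equiv.Perm (Fin m)) (π : Fin m → Equiv.Perm (Fin kk)) :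
    Equiv.Perm (Fin m × (Fin m × Fin kk)) where
  toFun v := (ρ v.1, (κ v.2.1, π v.2.1 v.2.2))
  invFun v := (ρ.symm v.1, (κ.symm v.2.1, (π (κ.symm v.2.1)).symm v.2.2))
  left_inv v := by simp
  right_inv v := by simp

/-- Unfolding `relabel`. [folklore] -/
private theorem relabel_apply (ρ κ : Equiv.Perm (Fin m)) (π : Fin m → Equiv.Perm (Fin kk))
    (v : Fin m × (Fin m × Fin kk)) : relabel ρ κ π v = (ρ v.1, (κ v.2.1, π v.2.1 v.2.2)) := rfl

/-- The induced bijection on column-choice functions `σ : [m] → [k]`: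
`σ ↦ (c' ↦ π_{κ⁻¹ c'} (σ (κ⁻¹ c')))`. [folklore] -/
def relabelChoice (κ : Equiv.Perm (Fin m)) (π : Fin m → Equiv.Perm (Fin kk)) :
    Equiv.Perm (Fin m → Fin kk) where
  toFun σ := fun c' => π (κ.symm c') (σ (κ.symm c'))
  invFun σ' := fun c => (π c).symm (σ' (κ c))
  left_inv σ := by funext c; simp
  right_inv σ' := by funext c'; simp

/-- **A relabelling maps each factor `det_σ` to `± det_{σ'}`**: renaming by `relabel ρ κ π` sends
the column-determinant of `σ` to `sign κ · sign ρ ·` the column-determinant of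
`relabelChoice κ π σ`. [folklore] -/
private theorem rename_relabel_det (ρ κ : Equiv.Perm (Fin m)) (π : Fin m → Equiv.Perm (Fin kk))
    (σ : Fin m → Fin kk) :
    rename (relabel ρ κ π)
        (Matrix.of fun r c : Fin m =>
          (X (r, (c, σ c)) : MvPolynomial (Fin m × (Fin m × Fin kk)) ℂ)).det =
      ((Equiv.Perm.sign κ : ℤ) : MvPolynomial (Fin m × (Fin m × Fin kk)) ℂ) *
        (((Equiv.Perm.sign ρ : ℤ) : MvPolynomial (Fin m × (Fin m × Fin kk)) ℂ) *
          (Matrix.of fun r c : Fin m =>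
            (X (r, (c, relabelChoice κ π σ c)) : MvPolynomial (Fin m × (Fin m × Fin kk)) ℂ)).det) := by
  set B : Matrix (Fin m) (Fin m) (MvPolynomial (Fin m × (Fin m × Fin kk)) ℂ) :=
    Matrix.of fun r c : Fin m => (X (r, (c, relabelChoice κ π σ c)) : MvPolynomial _ ℂ) with hB
  rw [AlgHom.map_det]
  have hmat : (rename (relabel ρ κ π)).mapMatrix
      (Matrix.of fun r c : Fin m => (X (r, (c, σ c)) : MvPolynomial (Fin m × (Fin m × Fin kk)) ℂ)) =
      (B.submatrix ρ id).submatrix id κ := by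
    ext r c
    simp only [AlgHom.mapMatrix_apply, Matrix.map_apply, Matrix.of_apply, rename_X, relabel_apply,
      Matrix.submatrix_apply, id_eq, hB, relabelChoice]
    simp
  rw [hmat, Matrix.det_permute', Matrix.det_permute]

/-- **`E(X)` is a relative invariant of the relabellings**:
`E(relabel X) = (sign κ · sign ρ)^{k^m} · E(X)` — the coordinate shadow of GCT I Prop. 7.1's
description of the stabilizer `K` of `E(X)` («The connected component K⁰ of the identity in
K is of the form ST, where S ≅ SL_m(F) …» acting by `X ↦ AX`, eq. (12), and «The discrete group
K/K⁰ contains the wreath product of the alternating group A_m and S_k (it acts on X by permuting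
its columns in the obvious way)», AV p.31, all.txt L2262–2285); OUR coordinate formulation (row
permutations and block / in-block column permutations, with the explicit sign).
[cite: MulmuleySohoniSIAM2001, Prop. 7.1 (AV p.31, all.txt L2262)] -/
theorem rename_relabel_msE (ρ κ : Equiv.Perm (Fin m)) (π : Fin m → Equiv.Perm (Fin kk)) :
    rename (relabel ρ κ π) (msE ℂ m kk) =
      C ((((Equiv.Perm.sign κ : ℤ) : ℂ) * ((Equiv.Perm.sign ρ : ℤ) : ℂ)) ^ Fintype.card (Fin m → Fin kk)) *
        msE ℂ m kk := by
  unfold msE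
  rw [map_prod]
  simp_rw [rename_relabel_det ρ κ π]
  rw [Finset.prod_mul_distrib, Finset.prod_mul_distrib, Finset.prod_const, Finset.prod_const,
    Finset.card_univ]
  rw [Fintype.prod_equiv (relabelChoice κ π)
    (fun σ => (Matrix.of fun r c : Fin m =>
      (X (r, (c, relabelChoice κ π σ c)) : MvPolynomial (Fin m × (Fin m × Fin kk)) ℂ)).det)
    (fun σ' => (Matrix.of fun r c : Fin m =>
      (X (r, (c, σ' c)) : MvPolynomial (Fin m × (Fin m × Fin kk)) ℂ)).det) (fun σ => rfl)]
  rw [← mul_assoc, ← mul_pow, map_pow, map_mul, map_intCast, map_intCast]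

/-- The scalar `(sign κ · sign ρ)^{k^m}` has norm one. [folklore] -/
private theorem norm_signScalar (ρ κ : Equiv.Perm (Fin m)) (K : ℕ) :
    ‖(((Equiv.Perm.sign κ : ℤ) : ℂ) * ((Equiv.Perm.sign ρ : ℤ) : ℂ)) ^ K‖ = 1 := by
  rw [norm_pow, norm_mul]
  have h : ∀ u : ℤˣ, ‖((u : ℤ) : ℂ)‖ = 1 := fun u => by
    rcases Int.units_eq_one_or u with hu | hu <;> simp [hu]
  rw [h, h, one_mul, one_pow]

/-- **The symmetric tensor of `E(X)` is a relative invariant of the relabellings**: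
`S (φ ∘ j) = ε · S j` with `φ = (relabel ρ κ π)⁻¹` and `ε = (sign κ sign ρ)^{k^m}`. [folklore] -/
private theorem symTensor_msE_relabel {D : ℕ} (ρ κ : Equiv.Perm (Fin m)) (π : Fin m → Equiv.Perm (Fin kk))
    (j : Fin D → Fin m × (Fin m × Fin kk)) :
    symTensor D (msE ℂ m kk) ((relabel ρ κ π).symm ∘ j) =
      (((Equiv.Perm.sign κ : ℤ) : ℂ) * ((Equiv.Perm.sign ρ : ℤ) : ℂ)) ^ Fintype.card (Fin m → Fin kk) *
        symTensor D (msE ℂ m kk) j := by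
  rw [symTensor_comp_left, Equiv.symm_symm, rename_relabel_msE, ← smul_eq_C_mul, symTensor_smul]

/-- **The relabellings act transitively on the variables.** [folklore] -/
private theorem exists_relabel_apply_eq (a b : Fin m × (Fin m × Fin kk)) :
    ∃ (ρ κ : Equiv.Perm (Fin m)) (π : Fin m → Equiv.Perm (Fin kk)), relabel ρ κ π b = a := by
  refine ⟨Equiv.swap b.1 a.1, Equiv.swap b.2.1 a.2.1,
    fun i => if i = b.2.1 then Equiv.swap b.2.2 a.2.2 else Equiv.refl _, ?_⟩
  rw [relabel_apply]
  simp only [Equiv.swap_apply_left, if_true]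

end FormE

end MS2001Thm73

open MS2001Thm73 in
/-- **`E(X)` is polystable over `ℂ`** — every `m`, `k`: the `SL_{km²}(ℂ)`-orbit of
`E(X) = ∏_σ det_σ(X)` under linear substitution is Zariski closed in coefficient space
(`IsPolystable`). Kempf–Ness route: `E(X)` is the shadow of its symmetric tensor, whose moment
matrix is scalar (rigid support by row/column multihomogeneity; transitive sign-symmetries).
[cite: MulmuleySohoniSIAM2001, Thm. 7.3 of the authors' version = journal Thm. 7.1 (AV p.31, all.txt L2342); BurgisserIkenmeyer2017 Prop. 2.8 (the polystability test, here in moment-map form)] -/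
theorem isPolystable_msE_complex (m kk : ℕ) : IsPolystable (msE ℂ m kk) := by
  rw [← tensorToPoly_symTensor (isHomogeneous_msE m kk)]
  obtain ⟨c, hc⟩ := exists_momentMatrix_eq_smul_one_of_rigid_of_transitive
    (symTensor (m * kk ^ m) (msE ℂ m kk)) (fun j k b h1 h2 => symTensor_msE_rigid j k b h1 h2)
    (fun a b => by
      obtain ⟨ρ, κ, π, h⟩ := exists_relabel_apply_eq (m := m) (kk := kk) a b
      refine ⟨(relabel ρ κ π).symm, _, norm_signScalar ρ κ (Fintype.card (Fin m → Fin kk)), ?_,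
        fun j => symTensor_msE_relabel ρ κ π j⟩
      rw [Equiv.symm_apply_eq]
      exact h.symm)
  exact isPolystable_tensorToPoly_of_momentMatrix_eq_smul_one
    (fun π j => symTensor_comp_perm _ π j) hc

/-- **GCT I, Thm. 7.3 (= journal Thm. 7.1) over `ℂ`, PROVED** — "The point `E(X) ∈ P(W)` is stable
with respect to the action of `G = SL_n(F)` on `P(W)`. We assume that the characteristic does not
divide `k`, `k − 1`, or `m`" (AV p.31, all.txt L2342–2347; `n = km²`, `W` = forms of degree
`deg E(X)`; "stable" = MS §3.1 = closed `SL`-orbit = `IsPolystable`) — at `F = ℂ`: literally the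
body of the named fact `MS2001_thm_7_3` instantiated at `ℂ` (its characteristic hypotheses, which
read `k ≠ 0`, `k ≠ 1`, `m ≠ 0` at characteristic `0`, are not needed by this proof). NOT by the
printed proof (§8: Kempf's criterion via one-parameter subgroups, absent from the tree) but by the
tree's Kempf–Ness route (`isPolystable_tensorToPoly_of_momentMatrix_eq_smul_one`), as for `det`/
`per` (`BurgisserIkenmeyer2017_polystable_det_per_holds`). The arbitrary-characteristic fact
`MS2001_thm_7_3` stays open. [cite: MulmuleySohoniSIAM2001, Thm. 7.3 of the authors' version = journal Thm. 7.1 (AV p.31, all.txt L2342)] -/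
theorem MS2001_thm_7_3_complex (m kk : ℕ) :
    ¬ (ringChar ℂ ∣ kk) → ¬ (ringChar ℂ ∣ (kk - 1)) → ¬ (ringChar ℂ ∣ m) →
      IsPolystable (msE ℂ m kk) :=
  fun _ _ _ => isPolystable_msE_complex m kk

end Literature.Computability.AlgebraicComplexity

end
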